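import Mathlib
import Literature.NumberTheory.LFunctions.Zhang2022.Section12Htilde15AFE
import Literature.NumberTheory.LFunctions.Zhang2022.Section11AFEWide
import HarnessLib

/-!
# Zhang (2022) §12 p. 67: the approximate functional equation of `H̃₁₅` (node `Z22:§12.u009`,
# `Typed.Sec12A.Htilde15ApproxFE` in the ε-carrying reading) on its FULL typed range — UNCONDITIONAL

Topic `Literature/NumberTheory/LFunctions/Zhang2022` (Landau–Siegel audit tree; verdict-neutral).
Y. Zhang, *Discrete mean estimates and the Landau–Siegel zero*, arXiv:2211.02515v1 (2022)
[Zhang2022LandauSiegel] — **an unrefereed manuscript under adjudication** (campaign D-0069 /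
ZHANG-L discharge lane, WP12 helper H2 = H2-A (zl-libB-p8, `Section12Htilde15AFE`) ∘ H2-B (zl-w12-p4,
`Section11AFEWide`); nothing here bears on Theorems 1–2 or on Landau–Siegel zeros).

§12 p. 67, tex L3426–3429: "Assume `σ = 1/2`, `|t − 2πt₀| < 𝓛₁` … Using the proof of Lemma 11.2 with
`s + β₆` in place of `s` we deduce that `H̃₁₅(s,ψ) = (Z(s+β₆,ψχ)P₁^{β₆}/0.504) Σ_n χψ̄(n)
n^{−(1−s−β₆)} ∫_{0.496}^{0.5}{g(P^{0.5}Dt₀/n) − g(P^zDt₀/n)}dz + O(E(s+β₆,ψ))`." PROVED here in the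
ε-carrying reading of record (error `C·(E₂(s+β₆,ψ) + e^{−c𝓛¹⁰})`, as Lemma 6.1's `E₁` and the repaired
`Z22:§11.u024`, gap rows G-d44-1 / G-d42-3; «vs PRINT: printed display + Lemma 6.1's +ε in the
error»): `Typed.Sec12A.htilde15ApproxFEe_holds` = zl-libB-p8's reduction
`Typed.Sec12A.htilde15ApproxFEe_of_afeWide` applied to `Section11AFE.step11u024e_wide` (the §11
display on `|t − 2πt₀| < 𝓛₁ + 1`, which covers `s + β₆`, `β₆ = 3iα/2`). This is exactly the hypothesis
`hFE` of `Typed.Sec12A.eq128_of_sj_small` (zl-libB-p4, p477880). Theorem-only; 0 definitions, 0 facts.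

## References

* Y. Zhang, arXiv:2211.02515v1 (2022), §12 p. 67, tex L3426–3429; §11 Lemma 11.2 p. 65; §6 Lemma 6.1.
  [cite: Zhang2022LandauSiegel, §12 p.67; §11 Lemma 11.2]
-/

noncomputable section

open Complex Real ComplexConjugate MeasureTheory Set Filter Topology

namespace Literature.NumberTheory.LFunctions.Zhang2022.Typed.Sec12A

open Skeleton GaussWeight Section11AFE

/-- **`Z22:§12.u009` HOLDS (ε-carrying reading), full typed range**: there are `c > 0`, `C` such that
for all large `D`, every real primitive `χ (mod D)` with (A), every `ψ ∈ Ψ` and every `s` with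
`σ = 1/2`, `|t − 2πt₀| < 𝓛₁`:
`‖H̃₁₅(s,ψ) − (Z(s+β₆,ψχ)P₁^{β₆}/0.504)·Σ'_n dualTerm(s,n)‖ ≤ C·(E₂(s+β₆,ψ) + e^{−c𝓛¹⁰})`.
[cite: Zhang2022LandauSiegel, §12 p. 67, tex L3426–3429] -/
theorem htilde15ApproxFEe_holds :
    ∃ c : ℝ, 0 < c ∧ ∃ C : ℝ, ForAllLarge fun D _ χ => AssumptionA D χ → ∀ x : Chr D, ∀ s : ℂ,
      s.re = 1 / 2 → |s.im - 2 * π * t0 D| < ell1 D →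
        ‖Htilde15 χ x s - dualPrefactor χ x s * ∑' n : ℕ, dualTerm χ x s n‖ ≤
          C * (E2main χ x (s + beta6 D) + Real.exp (-c * ell D ^ 10)) :=
  htilde15ApproxFEe_of_afeWide step11u024e_wide

end Literature.NumberTheory.LFunctions.Zhang2022.Typed.Sec12A
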